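import Mathlib
import Summits.NavierStokesRegularity.NavierStokesRegularity.Theorems.TaoLadderRungTwoBreakBlowupRigidityOneFiniteDepth
import Summits.NavierStokesRegularity.NavierStokesRegularity.Theorems.TaoLadderRungTwoBreakBlowupRigidityOnePairRigidity
import HarnessLib

/-!
# EXTINGUISHABLE CORES: a table that is peelable off a set `C` carrying a finite INTERNAL support chain never blows up
  robustly — sharpening the non-emitting case of `…OutflowCore` — and, below the dyadic spread, the classification of
  blow-up PAIRS: a two-mode live part `{a, b}` must be TWIN-FED (`x_a x_b ↦ y_a` AND `x_a x_b ↦ y_b` both live), each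
  feed draining exactly one twin (census item (RP″) of K2(1) `TaoLadderRungTwoBreak.BlowupRigidityOne`,
  stmt-NavierStokesRegularity-20206; `--supports`)

MODEL lattice ODEs only (Tao 2016 §4 (4.1)–(4.3), Lemma 4.1 (4.5)–(4.8), Thm. 4.2 statement shape, §5 p. 25); nothing here is
a statement about the Navier–Stokes equations; NO item is closed.  DEF-FREE; ROUTE-INDEPENDENT MODULE (no `Theses` import).
Pure combinatorics of the structure constants on top of `…FiniteDepth` and `…PairRigidity`.

WHY.  `…OutflowCore` proved: robust blow-up ⇒ some self-sustaining core `C` EMITS INTO ITSELF (`α_{jk i,(0,0,1)} ≠ 0`,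
`j, k, i ∈ C`), because a table peelable off a closed NON-EMITTING set never blows up.  Emitting into itself is necessary
but not sufficient for a core to carry a cascade: the SINGLE-FEED PAIR (modes `a ≠ b`; `α_{ab a,(0,0,1)} = α_{ba a,(0,0,1)}
= u ≠ 0`, drain partner `α_{aa b,(0,1,0)} = α_{aa b,(1,0,0)} = −u`, all other constants `0`; symmetric, cancelling, in
`E₂(1)`) is an outflow-live core — `y_a` is fed by `x_a x_b`, `x_b` is driven by `x_a y_a` — yet from any one-shell datum
the exact lattice dies two shells up: shell `n+1` receives only mode `a`, and `{a}` alone emits nothing (no squares).  The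
right notion is an INTERNAL SUPPORT CHAIN of `C`: sets `C = E 0, E 1, …, E (L+1) = ∅` inside `C` obeying the chain
conditions (O), (A), (B) of `…FiniteDepth` for outputs in `C`.

* `supportChain_of_peelable_internalChain` — peelable off `C` (condition (P) of `…OutflowCore`) + an internal support
  chain of `C` reaching `∅` ⇒ a support chain with `D 0 = univ` (the exterior ranked below level `K₀ = sup rank + 1` as in
  `supportChain_of_peelable`, the internal chain appended on top: `D (K₀ + l) = E l`); the non-emitting case of
  `…OutflowCore` is `E 1 = ∅`;
* `not_noGlobalCascade_of_peelable_internalChain` — hence NO robust blow-up at any `ε₀ > 0` from any one-shell datum on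
  such a table of `E₂(R)`; the by-name census form («robust blow-up forces a PERPETUAL core») is the companion module
  `…PerpetualCore` (inside the route cone);
* below the dyadic spread (`E₂(R)`, `0 < R < 2`: square-free, pair rigidity): `rotor_eq_zero_on_pair` — a pair of modes
  carries NO intra-shell monomial; `not_noGlobalCascade_pair_of_outflow_eq_zero` — if the modes outside `{a, b}` are
  peelable and the cross feed `x_a x_b ↦ y_b` vanishes, the internal chain `{a,b} ⊋ {a} ⊋ ∅` extinguishes the table;
  `twinFed_of_noGlobalCascade_pair`, `pair_normalForm_of_noGlobalCascade` — a robust blow-up whose live part is a pair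
  forces `a ≠ b`, BOTH cross feeds `u = α_{ab a,(0,0,1)} ≠ 0`, `v = α_{ab b,(0,0,1)} ≠ 0`, no rotor, no squares, and for
  each feed exactly one drain partner (`−u` on `x_a y_a ↦ x_b` or on `x_b y_a ↦ x_a`; `−v` on `x_a y_b ↦ x_b` or on
  `x_b y_b ↦ x_a`) — four drain types; the twin-rotor table of `…TwinRotorTableDefs` is the (self, self) type, `u = v = 1`.

HONEST LABEL: bookkeeping normal form for the planner (where any proof or refutation of K2(1) / the rung leaf must work);
no stub, crux, rung or summit is proved; rung 0.
-/

noncomputable section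

-- the summit and its single sub-problem share the name (CONVENTIONS §1)
set_option linter.dupNamespace false

open Set Filter Topology MeasureTheory
open scoped RealInnerProductSpace

namespace Summit.NavierStokesRegularity.NavierStokesRegularity.Theorems

namespace BlowupRigidityOne

open Literature.Analysis.FluidPDE Literature.Analysis.FluidPDE.TaoCascade
  Literature.Analysis.FluidPDE.Tao2016AveragedNS

variable {m : ℕ} {R ε₀ : ℝ} {α : Fin m → Fin m → Fin m → ℤ × ℤ × ℤ → ℝ}

/-! ## Peelable exterior + extinguishable core ⇒ a finite support chain -/

/-- **PEELABLE OFF `C` WITH AN INTERNAL SUPPORT CHAIN ⇒ A GLOBAL SUPPORT CHAIN.**  Suppose (P) every driver of a mode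
outside `C` has an input outside `C` of lower rank, and `C = E 0, E 1, …, E (L+1) = ∅` is an INTERNAL support chain of `C`
(`E l ⊆ C`; (O) outflow from `E l × E l` into `C` lands in `E (l+1)`; (A) the rotor of `E l × E l` into `C` stays in `E l`;
(B) the back-reaction of `E (l+1) × E l` into `C` stays in `E l`).  Then with `K₀ := sup rank + 1` the family
`D n := C ∪ {i ∉ C : n ≤ rank i}` (`n < K₀`), `D (K₀ + l) := E l` is a support chain of `…FiniteDepth` with `D 0 = univ` and
`D (K₀ + L + 1) = ∅` (outputs outside `C` of monomials with both inputs in `C` are impossible under (P)).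
[cite: Tao2016AveragedNS, §4 (4.1); cell vocabulary (support chain, peelable table, internal support chain)] -/
theorem supportChain_of_peelable_internalChain {C : Finset (Fin m)} {rank : Fin m → ℕ}
    (hpeel : ∀ μ ∈ shiftSet, ∀ j k i, i ∉ C → α j k i μ ≠ 0 →
      (j ∉ C ∧ rank j < rank i) ∨ (k ∉ C ∧ rank k < rank i))
    {L : ℕ} {E : ℕ → Finset (Fin m)} (hE0 : E 0 = C) (hEL : E (L + 1) = ∅) (hEC : ∀ l, E l ⊆ C)
    (hOi : ∀ l j k i, j ∈ E l → k ∈ E l → i ∈ C → i ∉ E (l + 1) →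
      α j k i ((0 : ℤ), (0 : ℤ), (1 : ℤ)) = 0)
    (hAi : ∀ l j k i, j ∈ E l → k ∈ E l → i ∈ C → i ∉ E l →
      α j k i ((0 : ℤ), (0 : ℤ), (0 : ℤ)) = 0)
    (hBi : ∀ l j k i, j ∈ E (l + 1) → k ∈ E l → i ∈ C → i ∉ E l →
      α j k i ((1 : ℤ), (0 : ℤ), (0 : ℤ)) = 0 ∧ α k j i ((0 : ℤ), (1 : ℤ), (0 : ℤ)) = 0) :
    ∃ (K : ℕ) (D : ℕ → Finset (Fin m)), D 0 = Finset.univ ∧ D (K + 1) = ∅ ∧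
      (∀ n j k i, j ∈ D n → k ∈ D n → i ∉ D (n + 1) → α j k i ((0 : ℤ), (0 : ℤ), (1 : ℤ)) = 0) ∧
      (∀ n j k i, j ∈ D n → k ∈ D n → i ∉ D n → α j k i ((0 : ℤ), (0 : ℤ), (0 : ℤ)) = 0) ∧
      (∀ n j k i, j ∈ D (n + 1) → k ∈ D n → i ∉ D n →
        α j k i ((1 : ℤ), (0 : ℤ), (0 : ℤ)) = 0 ∧ α k j i ((0 : ℤ), (1 : ℤ), (0 : ℤ)) = 0) := by
  classical
  have h001 : ((0 : ℤ), (0 : ℤ), (1 : ℤ)) ∈ shiftSet := by simp [shiftSet]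
  have h000 : ((0 : ℤ), (0 : ℤ), (0 : ℤ)) ∈ shiftSet := by simp [shiftSet]
  have h100 : ((1 : ℤ), (0 : ℤ), (0 : ℤ)) ∈ shiftSet := by simp [shiftSet]
  have h010 : ((0 : ℤ), (1 : ℤ), (0 : ℤ)) ∈ shiftSet := by simp [shiftSet]
  set K₀ : ℕ := Finset.univ.sup rank + 1 with hK₀
  have hrank : ∀ i, rank i < K₀ := fun i =>
    Nat.lt_succ_of_le (Finset.le_sup (f := rank) (Finset.mem_univ i))
  have hK₀pos : 0 < K₀ := by rw [hK₀]; exact Nat.succ_pos _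
  set D : ℕ → Finset (Fin m) := fun n =>
    if n < K₀ then C ∪ Finset.univ.filter (fun i => i ∉ C ∧ n ≤ rank i) else E (n - K₀) with hD
  -- membership in the chain
  have memD : ∀ n i, i ∈ D n ↔
      (n < K₀ ∧ (i ∈ C ∨ (i ∉ C ∧ n ≤ rank i))) ∨ (K₀ ≤ n ∧ i ∈ E (n - K₀)) := by
    intro n i
    rw [hD]
    dsimp only
    by_cases hn : n < K₀
    · rw [if_pos hn]
      simp only [Finset.mem_union, Finset.mem_filter, Finset.mem_univ, true_and]
      constructor
      · intro h
        exact Or.inl ⟨hn, h⟩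
      · rintro (⟨-, h⟩ | ⟨h, -⟩)
        · exact h
        · exact absurd hn (not_lt.2 h)
    · rw [if_neg hn]
      constructor
      · intro h
        exact Or.inr ⟨not_lt.1 hn, h⟩
      · rintro (⟨h, -⟩ | ⟨-, h⟩)
        · exact absurd h hn
        · exact h
  -- `C ⊆ D n` up to level `K₀` (at `K₀` itself `D K₀ = E 0 = C`)
  have C_sub : ∀ n i, i ∈ C → n ≤ K₀ → i ∈ D n := by
    intro n i hi hn
    rcases Nat.lt_or_ge n K₀ with h | h
    · exact (memD n i).2 (Or.inl ⟨h, Or.inl hi⟩)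
    · have hnK : n = K₀ := le_antisymm hn h
      refine (memD n i).2 (Or.inr ⟨h, ?_⟩)
      rw [hnK, Nat.sub_self, hE0]
      exact hi
  -- exterior modes: in `D n` iff `n < K₀` and `n ≤ rank`
  have ext_mem : ∀ n i, i ∉ C → n < K₀ → n ≤ rank i → i ∈ D n := fun n i hi hn hr =>
    (memD n i).2 (Or.inl ⟨hn, Or.inr ⟨hi, hr⟩⟩)
  have of_ext : ∀ n i, i ∉ C → i ∈ D n → n < K₀ ∧ n ≤ rank i := by
    intro n i hi h
    rcases (memD n i).1 h with ⟨hn, hC | ⟨-, hr⟩⟩ | ⟨-, hmem⟩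
    · exact absurd hC hi
    · exact ⟨hn, hr⟩
    · exact absurd (hEC _ hmem) hi
  -- high levels are the internal chain
  have of_hi : ∀ n i, K₀ ≤ n → i ∈ D n → i ∈ E (n - K₀) := by
    intro n i hn h
    rcases (memD n i).1 h with ⟨hn', -⟩ | ⟨-, hmem⟩
    · exact absurd hn' (not_lt.2 hn)
    · exact hmem
  have to_hi : ∀ n i, K₀ ≤ n → i ∈ E (n - K₀) → i ∈ D n := fun n i hn h =>
    (memD n i).2 (Or.inr ⟨hn, h⟩)
  refine ⟨K₀ + L, D, ?_, ?_, ?_, ?_, ?_⟩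
  · -- `D 0 = univ`
    ext i
    simp only [Finset.mem_univ, iff_true]
    by_cases hi : i ∈ C
    · exact C_sub 0 i hi (Nat.zero_le _)
    · exact ext_mem 0 i hi hK₀pos (Nat.zero_le _)
  · -- `D (K₀ + L + 1) = E (L + 1) = ∅`
    ext i
    simp only [Finset.notMem_empty, iff_false]
    intro h
    have h' := of_hi (K₀ + L + 1) i (by omega) h
    rw [show K₀ + L + 1 - K₀ = L + 1 by omega, hEL] at h'
    exact Finset.notMem_empty i h'
  · -- (O)
    intro n j k i hj hk hi
    by_contra hne
    by_cases hiC : i ∈ C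
    · rcases Nat.lt_or_ge n K₀ with hn | hn
      · exact hi (C_sub (n + 1) i hiC (by omega))
      · have hEq : n + 1 - K₀ = (n - K₀) + 1 := by omega
        refine hne (hOi (n - K₀) j k i (of_hi n j hn hj) (of_hi n k hn hk) hiC ?_)
        intro hmem
        exact hi (to_hi (n + 1) i (by omega) (by rw [hEq]; exact hmem))
    · rcases hpeel _ h001 j k i hiC hne with ⟨hjC, hlt⟩ | ⟨hkC, hlt⟩
      · obtain ⟨hn, hr⟩ := of_ext n j hjC hj
        rcases Nat.lt_or_ge (n + 1) K₀ with hn1 | hn1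
        · exact hi (ext_mem (n + 1) i hiC hn1 (by omega))
        · have := hrank i
          omega
      · obtain ⟨hn, hr⟩ := of_ext n k hkC hk
        rcases Nat.lt_or_ge (n + 1) K₀ with hn1 | hn1
        · exact hi (ext_mem (n + 1) i hiC hn1 (by omega))
        · have := hrank i
          omega
  · -- (A)
    intro n j k i hj hk hi
    by_contra hne
    by_cases hiC : i ∈ C
    · rcases Nat.lt_or_ge n K₀ with hn | hn
      · exact hi (C_sub n i hiC hn.le)
      · exact hne (hAi (n - K₀) j k i (of_hi n j hn hj) (of_hi n k hn hk) hiC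
          (fun hmem => hi (to_hi n i hn hmem)))
    · rcases hpeel _ h000 j k i hiC hne with ⟨hjC, hlt⟩ | ⟨hkC, hlt⟩
      · obtain ⟨hn, hr⟩ := of_ext n j hjC hj
        exact hi (ext_mem n i hiC hn (by omega))
      · obtain ⟨hn, hr⟩ := of_ext n k hkC hk
        exact hi (ext_mem n i hiC hn (by omega))
  · -- (B)
    intro n j k i hj hk hi
    by_cases hiC : i ∈ C
    · rcases Nat.lt_or_ge n K₀ with hn | hn
      · exact absurd (C_sub n i hiC hn.le) hi
      · have hEq : n + 1 - K₀ = (n - K₀) + 1 := by omega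
        have hj' : j ∈ E ((n - K₀) + 1) := by
          rw [← hEq]
          exact of_hi (n + 1) j (by omega) hj
        exact hBi (n - K₀) j k i hj' (of_hi n k hn hk) hiC (fun hmem => hi (to_hi n i hn hmem))
    · constructor
      · by_contra hne
        rcases hpeel _ h100 j k i hiC hne with ⟨hjC, hlt⟩ | ⟨hkC, hlt⟩
        · obtain ⟨hn, hr⟩ := of_ext (n + 1) j hjC hj
          exact hi (ext_mem n i hiC (by omega) (by omega))
        · obtain ⟨hn, hr⟩ := of_ext n k hkC hk
          exact hi (ext_mem n i hiC hn (by omega))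
      · by_contra hne
        rcases hpeel _ h010 k j i hiC hne with ⟨hkC, hlt⟩ | ⟨hjC, hlt⟩
        · obtain ⟨hn, hr⟩ := of_ext n k hkC hk
          exact hi (ext_mem n i hiC hn (by omega))
        · obtain ⟨hn, hr⟩ := of_ext (n + 1) j hjC hj
          exact hi (ext_mem n i hiC (by omega) (by omega))

/-- **PEELABLE TABLES WITH AN EXTINGUISHABLE CORE NEVER BLOW UP ROBUSTLY.**  If `α ∈ E₂(R)` is peelable off `C` ((P))
and `C` admits an internal support chain reaching `∅`, then `¬ NoGlobalCascade ε₀ α X₀` for EVERY `ε₀ > 0` and EVERY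
one-shell datum: K2(1) and the rung leaf hold there with no threshold (vacuously).  Contains
`not_noGlobalCascade_of_peelable` (the case `E 1 = ∅`: `C` does not emit into itself).
[cite: Tao2016AveragedNS, §4 Thm. 4.2 (statement shape), Lemma 4.1 (4.5)–(4.8), §5 p. 25; cell vocabulary (`NoGlobalCascade`, peelable table, internal support chain)] -/
theorem not_noGlobalCascade_of_peelable_internalChain (hε : 0 < ε₀) (hα : InTableClass R α)
    {C : Finset (Fin m)} {rank : Fin m → ℕ}
    (hpeel : ∀ μ ∈ shiftSet, ∀ j k i, i ∉ C → α j k i μ ≠ 0 →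
      (j ∉ C ∧ rank j < rank i) ∨ (k ∉ C ∧ rank k < rank i))
    {L : ℕ} {E : ℕ → Finset (Fin m)} (hE0 : E 0 = C) (hEL : E (L + 1) = ∅) (hEC : ∀ l, E l ⊆ C)
    (hOi : ∀ l j k i, j ∈ E l → k ∈ E l → i ∈ C → i ∉ E (l + 1) →
      α j k i ((0 : ℤ), (0 : ℤ), (1 : ℤ)) = 0)
    (hAi : ∀ l j k i, j ∈ E l → k ∈ E l → i ∈ C → i ∉ E l →
      α j k i ((0 : ℤ), (0 : ℤ), (0 : ℤ)) = 0)
    (hBi : ∀ l j k i, j ∈ E (l + 1) → k ∈ E l → i ∈ C → i ∉ E l →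
      α j k i ((1 : ℤ), (0 : ℤ), (0 : ℤ)) = 0 ∧ α k j i ((0 : ℤ), (1 : ℤ), (0 : ℤ)) = 0)
    (X₀ : Fin m → ℝ) : ¬ NoGlobalCascade ε₀ α X₀ := by
  obtain ⟨K, D, hD0, hDK, hO, hA, hB⟩ :=
    supportChain_of_peelable_internalChain hpeel hE0 hEL hEC hOi hAi hBi
  exact not_noGlobalCascade_of_supportChain_univ hε hα hD0 hDK hO hA hB X₀

/-! ## Below the dyadic spread: blow-up pairs are twin-fed -/

/-- **A PAIR OF MODES CARRIES NO INTRA-SHELL MONOMIAL below the dyadic spread.**  On `α ∈ E₂(R)`, `0 < R < 2`, every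
rotor constant `α_{jk i,(0,0,0)}` with `j, k, i ∈ {a, b}` vanishes: each such index triple repeats a mode, and the
square-type orbits of (4.3) are killed by comparability (`sqCoeff_eq_zero_of_lt_two`).
[cite: Tao2016AveragedNS, §4 (4.2)–(4.3), §6.1; cell vocabulary (`InTableClass`)] -/
theorem rotor_eq_zero_on_pair (hα : InTableClass R α) (hR0 : 0 < R) (hR : R < 2) {a b j k i : Fin m}
    (hj : j = a ∨ j = b) (hk : k = a ∨ k = b) (hi : i = a ∨ i = b) :
    α j k i ((0 : ℤ), (0 : ℤ), (0 : ℤ)) = 0 := by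
  have S := fun p q : Fin m =>
    NoSurvivingEternalViscBddOne.SubDyadicSpread.sqCoeff_eq_zero_of_lt_two hα hR0 hR p q
  rcases hj with hj | hj <;> rcases hk with hk | hk <;> rcases hi with hi | hi <;> rw [hj, hk, hi]
  · exact (S a a).2.2.2.1
  · exact (S b a).2.2.2.1
  · exact (S b a).2.2.2.2.2
  · exact (S a b).2.2.2.2.1
  · exact (S b a).2.2.2.2.1
  · exact (S a b).2.2.2.2.2
  · exact (S a b).2.2.2.1
  · exact (S b b).2.2.2.1

/-- **ONE MISSING CROSS FEED EXTINGUISHES A PAIR.**  On `α ∈ E₂(R)`, `0 < R < 2`, suppose the modes outside the pair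
`{a, b}` are peelable ((P) relative to `C = {a, b}`) and the cross feed into `b` vanishes: `α_{ab b,(0,0,1)} = 0`.  Then
`{a, b} ⊋ {a} ⊋ ∅` is an internal support chain (a `{a,b}`-shell emits only into mode `a` — squares vanish — and an
`{a}`-shell emits nothing and has no rotor), so `¬ NoGlobalCascade ε₀ α X₀` for every `ε₀ > 0` and every one-shell
datum.  (The single-feed pair of the module docstring is the case `α_{ab a,(0,0,1)} ≠ 0`.)
[cite: Tao2016AveragedNS, §4 Thm. 4.2 (statement shape), (4.2)–(4.3), §6.1; cell vocabulary (`NoGlobalCascade`, `InTableClass`, internal support chain)] -/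
theorem not_noGlobalCascade_pair_of_outflow_eq_zero (hε : 0 < ε₀) (hα : InTableClass R α) (hR0 : 0 < R)
    (hR : R < 2) {a b : Fin m} {rank : Fin m → ℕ}
    (hpeel : ∀ μ ∈ shiftSet, ∀ j k i, i ∉ ({a, b} : Finset (Fin m)) → α j k i μ ≠ 0 →
      (j ∉ ({a, b} : Finset (Fin m)) ∧ rank j < rank i) ∨ (k ∉ ({a, b} : Finset (Fin m)) ∧ rank k < rank i))
    (hv : α a b b ((0 : ℤ), (0 : ℤ), (1 : ℤ)) = 0) (X₀ : Fin m → ℝ) : ¬ NoGlobalCascade ε₀ α X₀ := by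
  classical
  obtain ⟨hs, -, -⟩ := id hα
  have h001 : ((0 : ℤ), (0 : ℤ), (1 : ℤ)) ∈ shiftSet := by simp [shiftSet]
  have S := fun p q : Fin m =>
    NoSurvivingEternalViscBddOne.SubDyadicSpread.sqCoeff_eq_zero_of_lt_two hα hR0 hR p q
  -- squares do not emit: `α_{jj i,(0,0,1)} = 0`
  have sq : ∀ j i : Fin m, α j j i ((0 : ℤ), (0 : ℤ), (1 : ℤ)) = 0 := fun j i => (S i j).1
  have hv' : α b a b ((0 : ℤ), (0 : ℤ), (1 : ℤ)) = 0 := by rw [← hs a b b 0 0 1 h001]; exact hv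
  have mem_pair : ∀ i : Fin m, i ∈ ({a, b} : Finset (Fin m)) ↔ i = a ∨ i = b := fun i => by
    rw [Finset.mem_insert, Finset.mem_singleton]
  -- the internal chain `{a,b}, {a}, ∅, ∅, …`
  let E : ℕ → Finset (Fin m) := fun l => if l = 0 then {a, b} else if l = 1 then {a} else ∅
  have hE0 : E 0 = {a, b} := rfl
  have hE1 : E 1 = {a} := rfl
  have hEge : ∀ l, 2 ≤ l → E l = ∅ := by
    intro l hl
    show (if l = 0 then {a, b} else if l = 1 then {a} else ∅) = (∅ : Finset (Fin m))
    rw [if_neg (by omega), if_neg (by omega)]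
  have hEC : ∀ l, E l ⊆ ({a, b} : Finset (Fin m)) := by
    intro l
    rcases Nat.lt_or_ge l 2 with hl | hl
    · interval_cases l
      · exact le_of_eq hE0
      · rw [hE1]
        intro i hi
        rw [Finset.mem_singleton] at hi
        rw [mem_pair]
        exact Or.inl hi
    · rw [hEge l hl]
      exact Finset.empty_subset _
  refine not_noGlobalCascade_of_peelable_internalChain hε hα hpeel (L := 1) (E := E) hE0 (hEge 2 le_rfl) hEC
    ?_ ?_ ?_ X₀
  · -- (O): a `{a,b}`-shell emits only into `a`; an `{a}`-shell does not emit
    intro l j k i hj hk hiC hi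
    rcases Nat.lt_or_ge l 2 with hl | hl
    · interval_cases l
      · -- `l = 0`: output `i ∈ {a,b} \ {a}`, i.e. `i = b`
        rw [hE0, mem_pair] at hj hk
        have hib : i = b := by
          rw [mem_pair] at hiC
          rcases hiC with h | h
          · exact absurd (by rw [hE1, Finset.mem_singleton]; exact h) hi
          · exact h
        rcases hj with hj | hj <;> rcases hk with hk | hk <;> rw [hj, hk, hib]
        · exact sq a b
        · exact hv
        · exact hv'
        · exact sq b b
      · -- `l = 1`: inputs `j = k = a`
        rw [hE1, Finset.mem_singleton] at hj hk
        rw [hj, hk]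
        exact sq a i
    · rw [hEge l hl] at hj
      exact absurd hj (Finset.notMem_empty j)
  · -- (A): no rotor on the pair at all
    intro l j k i hj hk hiC _
    have hj' := hEC l hj
    have hk' := hEC l hk
    rw [mem_pair] at hj' hk' hiC
    exact rotor_eq_zero_on_pair hα hR0 hR hj' hk' hiC
  · -- (B): at `l = 0` the target `{a,b} \ E 0` is empty; above, `E (l+1) = ∅`
    intro l j k i hj _ hiC hi
    rcases Nat.eq_zero_or_pos l with rfl | hl
    · exact absurd (by rw [hE0]; exact hiC) hi
    · rw [hEge (l + 1) (by omega)] at hj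
      exact absurd hj (Finset.notMem_empty j)

/-- **BLOW-UP PAIRS ARE TWIN-FED.**  On `α ∈ E₂(R)`, `0 < R < 2`, if the modes outside a pair `{a, b}` are peelable and
the table blows up robustly from some one-shell datum at some `ε₀ > 0`, then BOTH cross feeds are live:
`α_{ab a,(0,0,1)} ≠ 0` (`x_a x_b ↦ y_a`) and `α_{ab b,(0,0,1)} ≠ 0` (`x_a x_b ↦ y_b`).
[cite: Tao2016AveragedNS, §4 Thm. 4.2 (statement shape), (4.2)–(4.3), §6.1; cell vocabulary (`NoGlobalCascade`, `InTableClass`)] -/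
theorem twinFed_of_noGlobalCascade_pair (hε : 0 < ε₀) (hα : InTableClass R α) (hR0 : 0 < R) (hR : R < 2)
    {a b : Fin m} {rank : Fin m → ℕ}
    (hpeel : ∀ μ ∈ shiftSet, ∀ j k i, i ∉ ({a, b} : Finset (Fin m)) → α j k i μ ≠ 0 →
      (j ∉ ({a, b} : Finset (Fin m)) ∧ rank j < rank i) ∨ (k ∉ ({a, b} : Finset (Fin m)) ∧ rank k < rank i))
    {X₀ : Fin m → ℝ} (hNG : NoGlobalCascade ε₀ α X₀) :
    α a b a ((0 : ℤ), (0 : ℤ), (1 : ℤ)) ≠ 0 ∧ α a b b ((0 : ℤ), (0 : ℤ), (1 : ℤ)) ≠ 0 := by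
  obtain ⟨hs, -, -⟩ := id hα
  have h001 : ((0 : ℤ), (0 : ℤ), (1 : ℤ)) ∈ shiftSet := by simp [shiftSet]
  refine ⟨fun hu => ?_, fun hv => not_noGlobalCascade_pair_of_outflow_eq_zero hε hα hR0 hR hpeel hv X₀ hNG⟩
  -- the feed into `a` vanishes: use the chain `{b,a} ⊋ {b} ⊋ ∅`
  have hu' : α b a a ((0 : ℤ), (0 : ℤ), (1 : ℤ)) = 0 := by rw [← hs a b a 0 0 1 h001]; exact hu
  have hpair : ({b, a} : Finset (Fin m)) = {a, b} := Finset.pair_comm b a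
  have hpeel' : ∀ μ ∈ shiftSet, ∀ j k i, i ∉ ({b, a} : Finset (Fin m)) → α j k i μ ≠ 0 →
      (j ∉ ({b, a} : Finset (Fin m)) ∧ rank j < rank i) ∨
        (k ∉ ({b, a} : Finset (Fin m)) ∧ rank k < rank i) := by
    rw [hpair]
    exact hpeel
  exact not_noGlobalCascade_pair_of_outflow_eq_zero hε hα hR0 hR hpeel' hu' X₀ hNG

/-- **NORMAL FORM OF A BLOW-UP PAIR (census item (RP″)).**  On `α ∈ E₂(R)`, `0 < R < 2`, if the modes outside `{a, b}`
are peelable and `NoGlobalCascade ε₀ α X₀` holds for some `ε₀ > 0` and some one-shell datum, then: `a ≠ b`; both cross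
feeds `u = α_{ab a,(0,0,1)}`, `v = α_{ab b,(0,0,1)}` are non-zero; the pair carries no rotor (`rotor_eq_zero_on_pair`) and
no square monomial (`sqCoeff_eq_zero_of_lt_two`); and each feed has EXACTLY ONE drain partner — for `u` either the cross
drain `α_{aa b,(0,1,0)} = −u` (`x_a y_a ↦ x_b`) with `α_{ba a,(0,1,0)} = 0`, or the self drain `α_{ba a,(0,1,0)} = −u`
(`x_b y_a ↦ x_a`) with `α_{aa b,(0,1,0)} = 0`; for `v` either the self drain `α_{ab b,(0,1,0)} = −v` (`x_a y_b ↦ x_b`) with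
`α_{bb a,(0,1,0)} = 0`, or the cross drain `α_{bb a,(0,1,0)} = −v` (`x_b y_b ↦ x_a`) with `α_{ab b,(0,1,0)} = 0`.  Four
drain types; the twin-rotor table of `…TwinRotorTableDefs` is the (self, self) type with `u = v = 1`.
[cite: Tao2016AveragedNS, §4 Thm. 4.2 (statement shape), (4.1)–(4.3), §6.1; cell vocabulary (`NoGlobalCascade`, `InTableClass`)] -/
theorem pair_normalForm_of_noGlobalCascade (hε : 0 < ε₀) (hα : InTableClass R α) (hR0 : 0 < R) (hR : R < 2)
    {a b : Fin m} {rank : Fin m → ℕ}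
    (hpeel : ∀ μ ∈ shiftSet, ∀ j k i, i ∉ ({a, b} : Finset (Fin m)) → α j k i μ ≠ 0 →
      (j ∉ ({a, b} : Finset (Fin m)) ∧ rank j < rank i) ∨ (k ∉ ({a, b} : Finset (Fin m)) ∧ rank k < rank i))
    {X₀ : Fin m → ℝ} (hNG : NoGlobalCascade ε₀ α X₀) :
    a ≠ b ∧
      α a b a ((0 : ℤ), (0 : ℤ), (1 : ℤ)) ≠ 0 ∧ α a b b ((0 : ℤ), (0 : ℤ), (1 : ℤ)) ≠ 0 ∧
      ((α a a b ((0 : ℤ), (1 : ℤ), (0 : ℤ)) = -α a b a ((0 : ℤ), (0 : ℤ), (1 : ℤ)) ∧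
          α b a a ((0 : ℤ), (1 : ℤ), (0 : ℤ)) = 0) ∨
        (α b a a ((0 : ℤ), (1 : ℤ), (0 : ℤ)) = -α a b a ((0 : ℤ), (0 : ℤ), (1 : ℤ)) ∧
          α a a b ((0 : ℤ), (1 : ℤ), (0 : ℤ)) = 0)) ∧
      ((α a b b ((0 : ℤ), (1 : ℤ), (0 : ℤ)) = -α a b b ((0 : ℤ), (0 : ℤ), (1 : ℤ)) ∧
          α b b a ((0 : ℤ), (1 : ℤ), (0 : ℤ)) = 0) ∨
        (α b b a ((0 : ℤ), (1 : ℤ), (0 : ℤ)) = -α a b b ((0 : ℤ), (0 : ℤ), (1 : ℤ)) ∧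
          α a b b ((0 : ℤ), (1 : ℤ), (0 : ℤ)) = 0)) := by
  obtain ⟨hu, hv⟩ := twinFed_of_noGlobalCascade_pair hε hα hR0 hR hpeel hNG
  obtain ⟨hab, hpu⟩ := outflow_single_partner_of_lt_two hα hR0 hR hu
  obtain ⟨-, hpv⟩ := outflow_single_partner_of_lt_two hα hR0 hR hv
  exact ⟨hab, hu, hv, hpu, hpv⟩

end BlowupRigidityOne

end Summit.NavierStokesRegularity.NavierStokesRegularity.Theorems

end
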